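import Summits.BirchSwinnertonDyer.BirchSwinnertonDyer.Theorems.UniversalToricDescentTwinDecLocusTateCube
import Mathlib.NumberTheory.Padics.Hensel
import Mathlib.NumberTheory.Padics.RingHoms
import HarnessLib

/-!
# Route `UniversalToricDescent`, lines `threeframes` v5 (20694) / `membertower` v2 (26062), stub `stub_wanFrameMultNoDec`:
# the CUBE TEST in `ℚ₃` — `q ∈ (ℚ₃ˣ)³ ⟺ q = a·3^{3k}` with `a ≡ ±1 (mod 9)` — so the residual (no-(dec)) locus of the
# member-tower line is DECIDABLE from `(v₃(Δ_min(W′)), q_{W′}·3^{−v₃ q} mod 9)`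

Cell `bsd-wall` (run/shared/lean/pub/bsd-wall/), width seat `bsd-wall-utd-p2-w2` (prover g2, 2026-08-28);
`--supports stmt-BirchSwinnertonDyer-20694 --as helper`; Theses-free; sequel of
`UniversalToricDescentTwinDecLocusTateCube.lean` (p612881: (dec) `W′(ℚ₃)[3] = 0` ⟺ no Tate datum with `q = u³`).

* §1 `exists_cube_root_of_toZModPow_two` — HENSEL: a 3-adic integer `a ≡ ±1 (mod 9)` is a cube in `ℤ_[3]` (the cube
  roots mod 27 of the six residues `≡ ±1 (mod 9)` are `1, 4, 7, 2, 5, 8`; `‖a₀³ − a‖ ≤ 3⁻³ < 3⁻² = ‖3a₀²‖²`);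
  `toZModPow_two_pow_three_of_isUnit` — conversely the cube of a 3-adic unit is `≡ ±1 (mod 9)` (the unit cubes of
  `ℤ/9`); `exists_pow_three_eq_iff` — **for `q ∈ ℚ₃`: `(∃ u, u³ = q) ⟺ ∃ (a : ℤ_[3]) (k : ℤ), q = a·3^{3k} ∧ a ≡ ±1 (mod 9)`**.
* §2 `twin_cube_locus_iff` — at a Tate datum `D` of the twin `W′` at 3: the residual locus of p612881
  (`∃ u : ℚ_[3], u³ = D.q`) ⟺ `∃ a k, D.q = a·3^{3k} ∧ a ≡ ±1 (mod 9)`; and `three_mul_eq_valuation_of_eq` — in any such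
  writing `3k = v₃(q) = v₃(Δ_min(W′))` (`valuation_q_eq_padicValInt_holds`), i.e. the test reads
  «`3 ∣ v₃(Δ_min(W′))` and `q·3^{−v₃(q)} ≡ ±1 (mod 9)`» — census ask D7″.

HONEST FRAMING: theorems only (no definition, no named fact, no instance, no `sorry`); elementary 3-adic arithmetic
(Mathlib's `hensels_lemma`, `PadicInt.toZModPow`, two `decide`s over `ℤ/27`, `ℤ/9`); nothing about BSD is proved;
the residual stub stays research on the locus this file makes explicit.

References: [Serre1973] Ch. II §3.2 (units of `ℤ_p`, `p`-th powers); [SilvermanATAEC1994] Thm. V.3.1 (d), V.5.3;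
[MazurTateTeitelbaum1986Invent] §II.1 (`ord_p q = ord_p Δ_min`).
-/

noncomputable section

open scoped Classical

set_option linter.dupNamespace false
set_option autoImplicit false

namespace Summit.BirchSwinnertonDyer.BirchSwinnertonDyer.Theorems.UniversalToricDescentTwinDecLocusCubeTest

open WeierstrassCurve Literature.NumberTheory.EllipticCurves Polynomial

/-! ### §1 The cube test in `ℚ₃` -/

section Padic


/-- The six residues mod 27 that are `≡ ±1 (mod 9)` are cubes mod 27 (roots `1, 4, 7, 2, 5, 8`). [folklore] -/
theorem exists_cube_root_zmod27 :
    ∀ r : ZMod (3 ^ 3), ((ZMod.castHom (show 3 ^ 2 ∣ 3 ^ 3 by decide) (ZMod (3 ^ 2)) r = 1) ∨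
        (ZMod.castHom (show 3 ^ 2 ∣ 3 ^ 3 by decide) (ZMod (3 ^ 2)) r = -1)) →
      ∃ s : ZMod (3 ^ 3), s ^ 3 = r := by
  decide

/-- The cube of a unit of `ℤ/9` is `±1`. [folklore] -/
theorem zmod9_unit_cube : ∀ x y : ZMod (3 ^ 2), x * y = 1 → x ^ 3 = 1 ∨ x ^ 3 = -1 := by
  decide

/-- A 3-adic integer congruent to `±1 (mod 9)` has norm one. [folklore] -/
theorem norm_eq_one_of_toZModPow_two {a : ℤ_[3]}
    (ha : PadicInt.toZModPow 2 a = 1 ∨ PadicInt.toZModPow 2 a = -1) : ‖a‖ = 1 := by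
  -- `a - ε ∈ (9)` for `ε = ±1`, so `‖a - ε‖ < 1 = ‖ε‖`
  obtain ⟨ε, hε1, hεa⟩ : ∃ ε : ℤ_[3], ‖ε‖ = 1 ∧ PadicInt.toZModPow 2 (a - ε) = 0 := by
    rcases ha with h | h
    · exact ⟨1, by simp, by rw [map_sub, h, map_one, sub_self]⟩
    · exact ⟨-1, by simp, by rw [map_sub, h, map_neg, map_one, sub_self]⟩
  have hmem : a - ε ∈ (Ideal.span {((3 : ℕ) : ℤ_[3]) ^ 2} : Ideal ℤ_[3]) := by
    rw [← PadicInt.ker_toZModPow]; exact hεa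
  have hlt : ‖a - ε‖ < ‖ε‖ := by
    rw [hε1]
    have h9 : ‖a - ε‖ ≤ ((3 : ℕ) : ℝ) ^ (-(2 : ℕ) : ℤ) := (PadicInt.norm_le_pow_iff_mem_span_pow _ 2).2 hmem
    push_cast at h9
    exact lt_of_le_of_lt h9 (by norm_num)
  have hne : ‖a - ε‖ ≠ ‖ε‖ := hlt.ne
  calc ‖a‖ = ‖(a - ε) + ε‖ := by rw [sub_add_cancel]
    _ = max ‖a - ε‖ ‖ε‖ := PadicInt.norm_add_eq_max_of_ne hne
    _ = ‖ε‖ := max_eq_right hlt.le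
    _ = 1 := hε1

/-- **HENSEL: a 3-adic integer `a ≡ ±1 (mod 9)` is a cube in `ℤ_[3]`.** Choose `a₀ ∈ {1,4,7,2,5,8}` with
`a₀³ ≡ a (mod 27)` (`exists_cube_root_zmod27`); then `‖a₀³ − a‖ ≤ 3⁻³ < 3⁻² = ‖3a₀²‖²` and Mathlib's `hensels_lemma`
for `F = X³ − a` gives the root. [cite: Serre1973, Ch. II §3.2 (structure of the units of ℤ_p)] -/
theorem exists_cube_root_of_toZModPow_two {a : ℤ_[3]}
    (ha : PadicInt.toZModPow 2 a = 1 ∨ PadicInt.toZModPow 2 a = -1) : ∃ z : ℤ_[3], z ^ 3 = a := by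
  have ha1 : ‖a‖ = 1 := norm_eq_one_of_toZModPow_two ha
  -- a cube root mod 27
  have hcast : (ZMod.castHom (show 3 ^ 2 ∣ 3 ^ 3 by decide) (ZMod (3 ^ 2)) (PadicInt.toZModPow 3 a) = 1) ∨
      (ZMod.castHom (show 3 ^ 2 ∣ 3 ^ 3 by decide) (ZMod (3 ^ 2)) (PadicInt.toZModPow 3 a) = -1) := by
    have hc : (ZMod.castHom (show 3 ^ 2 ∣ 3 ^ 3 by decide) (ZMod (3 ^ 2))) (PadicInt.toZModPow 3 a) =
        PadicInt.toZModPow 2 a := by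
      rw [ZMod.castHom_apply]
      exact PadicInt.cast_toZModPow 2 3 (by norm_num) a
    rw [hc]; exact ha
  obtain ⟨s, hs⟩ := exists_cube_root_zmod27 _ hcast
  set a₀ : ℤ_[3] := (s.val : ℤ_[3]) with ha₀
  have hs₀ : PadicInt.toZModPow 3 a₀ = s := by
    rw [ha₀, map_natCast, ZMod.natCast_zmod_val]
  -- `a₀³ - a ∈ (27)`
  have hker : PadicInt.toZModPow 3 (a₀ ^ 3 - a) = 0 := by
    rw [map_sub, map_pow, hs₀, hs, sub_self]
  have hmem : a₀ ^ 3 - a ∈ (Ideal.span {((3 : ℕ) : ℤ_[3]) ^ 3} : Ideal ℤ_[3]) := by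
    rw [← PadicInt.ker_toZModPow]; exact hker
  have h27 : ‖a₀ ^ 3 - a‖ ≤ (3 : ℝ) ^ (-(3 : ℕ) : ℤ) := by
    have h := (PadicInt.norm_le_pow_iff_mem_span_pow _ 3).2 hmem
    push_cast at h
    exact h
  -- `a₀` is a unit: `‖a₀³‖ = ‖a‖ = 1`
  have ha₀1 : ‖a₀‖ = 1 := by
    have hlt : ‖a₀ ^ 3 - a‖ < ‖a‖ := by rw [ha1]; exact lt_of_le_of_lt h27 (by norm_num)
    have h3 : ‖a₀ ^ 3‖ = 1 := by
      calc ‖a₀ ^ 3‖ = ‖(a₀ ^ 3 - a) + a‖ := by rw [sub_add_cancel]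
        _ = max ‖a₀ ^ 3 - a‖ ‖a‖ := PadicInt.norm_add_eq_max_of_ne hlt.ne
        _ = ‖a‖ := max_eq_right hlt.le
        _ = 1 := ha1
    rw [norm_pow] at h3
    exact (pow_eq_one_iff_of_nonneg (norm_nonneg _) (by norm_num)).1 h3
  -- Hensel for `F = X³ - a` at `a₀`
  set F : ℤ_[3][X] := X ^ 3 - C a with hF
  have hFa : ∀ x : ℤ_[3], F.aeval x = x ^ 3 - a := fun x => by
    simp [hF, map_sub, map_pow, aeval_X, aeval_C]
  have hF' : ∀ x : ℤ_[3], F.derivative.aeval x = 3 * x ^ 2 := fun x => by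
    simp [hF, map_mul, map_pow, aeval_X]
    norm_num
  have hnorm : ‖F.aeval a₀‖ < ‖F.derivative.aeval a₀‖ ^ 2 := by
    rw [hFa, hF', norm_mul, norm_pow, ha₀1, one_pow, mul_one]
    have h3 : ‖(3 : ℤ_[3])‖ = (3 : ℝ)⁻¹ := by exact_mod_cast PadicInt.norm_p (p := 3)
    rw [h3]
    exact lt_of_le_of_lt h27 (by norm_num)
  obtain ⟨z, hz, -⟩ := hensels_lemma hnorm
  refine ⟨z, ?_⟩
  rw [hFa] at hz
  exact sub_eq_zero.1 hz

/-- **The cube of a 3-adic unit is `≡ ±1 (mod 9)`** (its image in `(ℤ/9)ˣ ≅ C₆` is a unit cube). [folklore] -/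
theorem toZModPow_two_pow_three_of_isUnit {A : ℤ_[3]} (hA : IsUnit A) :
    PadicInt.toZModPow 2 (A ^ 3) = 1 ∨ PadicInt.toZModPow 2 (A ^ 3) = -1 := by
  obtain ⟨B, hB⟩ := hA.exists_right_inv
  rw [map_pow]
  exact zmod9_unit_cube _ (PadicInt.toZModPow 2 B) (by rw [← map_mul, hB, map_one])

/-- **THE CUBE TEST IN `ℚ₃`**: a non-zero `q ∈ ℚ₃` is a cube iff `q = a·3^{3k}` for some `a ∈ ℤ_[3]` with
`a ≡ ±1 (mod 9)` and some `k ∈ ℤ` (i.e. `3 ∣ v₃(q)` and the unit part of `q` is `≡ ±1 (mod 9)`; stated for `q ≠ 0`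
because `0 = 0³` is a cube while `0 ≢ ±1`). (⇒): `u = U·3^n` with `U` a unit of `ℤ_[3]`, `a = U³`, `k = n`
(`toZModPow_two_pow_three_of_isUnit`); (⇐): Hensel (`exists_cube_root_of_toZModPow_two`). [cite: Serre1973, Ch. II §3.2] -/
theorem exists_pow_three_eq_iff {q : ℚ_[3]} (hq : q ≠ 0) :
    (∃ u : ℚ_[3], u ^ 3 = q) ↔
      ∃ (a : ℤ_[3]) (k : ℤ), q = (a : ℚ_[3]) * (3 : ℚ_[3]) ^ (3 * k) ∧
        (PadicInt.toZModPow 2 a = 1 ∨ PadicInt.toZModPow 2 a = -1) := by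
  constructor
  · rintro ⟨u, rfl⟩
    have hu : u ≠ 0 := fun h => hq (by rw [h]; ring)
    -- `u = U · 3^n`, `U` a 3-adic unit
    set n : ℤ := u.valuation with hn
    have h3 : (3 : ℚ_[3]) ≠ 0 := by exact_mod_cast (Nat.prime_three.ne_zero)
    have hun : ‖u‖ = (3 : ℝ) ^ (-n) := by
      rw [hn]; exact_mod_cast Padic.norm_eq_zpow_neg_valuation hu
    have h3n : ‖(3 : ℚ_[3])‖ = (3 : ℝ)⁻¹ := by exact_mod_cast Padic.norm_p (p := 3)
    have hU1 : ‖u * (3 : ℚ_[3]) ^ (-n)‖ = 1 := by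
      rw [norm_mul, norm_zpow, hun, h3n, inv_zpow', neg_neg, ← zpow_add₀ (by norm_num : (3 : ℝ) ≠ 0),
        neg_add_cancel, zpow_zero]
    set U : ℤ_[3]ˣ := PadicInt.mkUnits hU1 with hUdef
    have hUcoe : ((U : ℤ_[3]) : ℚ_[3]) = u * (3 : ℚ_[3]) ^ (-n) := rfl
    refine ⟨(U : ℤ_[3]) ^ 3, n, ?_, toZModPow_two_pow_three_of_isUnit U.isUnit⟩
    have hexp : -n * ((3 : ℕ) : ℤ) + 3 * n = 0 := by push_cast; ring
    rw [PadicInt.coe_pow, hUcoe, mul_pow, ← zpow_natCast ((3 : ℚ_[3]) ^ (-n)) 3, ← zpow_mul, mul_assoc,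
      ← zpow_add₀ h3, hexp, zpow_zero, mul_one]
  · rintro ⟨a, k, hqa, ha⟩
    obtain ⟨z, hz⟩ := exists_cube_root_of_toZModPow_two ha
    refine ⟨(z : ℚ_[3]) * (3 : ℚ_[3]) ^ k, ?_⟩
    have hexp : k * ((3 : ℕ) : ℤ) = 3 * k := by push_cast; ring
    rw [hqa, mul_pow, ← PadicInt.coe_pow, hz, ← zpow_natCast ((3 : ℚ_[3]) ^ k) 3, ← zpow_mul, hexp]

end Padic

/-! ### §2 The residual locus of the member-tower line in curve currency -/

section Twin

variable (W' : WeierstrassCurve ℚ) [W'.IsElliptic]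

/-- **THE RESIDUAL (no-(dec)) LOCUS OF THE MEMBER-TOWER LINE, DECIDED**: at a Tate parameter datum `D` of the twin `W′`
at 3 (so `W′` is split multiplicative at 3), `q_{W′} = D.q` is a cube in `ℚ₃` — equivalently (p612881
`twin_not_dec_of_cube` / `twin_dec_or_cube`) `W′(ℚ₃)[3] ≠ 0` — iff `D.q = a·3^{3k}` with `a ≡ ±1 (mod 9)`.
[cite: SilvermanATAEC1994, Thm. V.3.1 (d) and Thm. V.5.3] [cite: Serre1973, Ch. II §3.2] -/
theorem twin_cube_locus_iff (D : TateParameterData W' 3) :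
    (∃ u : ℚ_[3], u ^ 3 = D.q) ↔
      ∃ (a : ℤ_[3]) (k : ℤ), D.q = (a : ℚ_[3]) * (3 : ℚ_[3]) ^ (3 * k) ∧
        (PadicInt.toZModPow 2 a = 1 ∨ PadicInt.toZModPow 2 a = -1) :=
  exists_pow_three_eq_iff D.q_ne_zero

/-- **In any writing `q = a·3^{3k}` with `a ≡ ±1 (mod 9)`: `3k = v₃(q) = v₃(Δ_min(W′))`** — so the test reads
«`3 ∣ v₃(Δ_min(W′))` and `q·3^{−v₃(Δ_min)} ≡ ±1 (mod 9)`» (census ask D7″). [cite: MazurTateTeitelbaum1986Invent, §II.1] -/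
theorem three_mul_eq_valuation_of_eq [W'.IsGloballyMinimal] (D : TateParameterData W' 3) {a : ℤ_[3]} {k : ℤ}
    (hqa : D.q = (a : ℚ_[3]) * (3 : ℚ_[3]) ^ (3 * k))
    (ha : PadicInt.toZModPow 2 a = 1 ∨ PadicInt.toZModPow 2 a = -1) :
    3 * k = (padicValInt 3 W'.minimalDiscriminantInt : ℤ) := by
  have ha1 : ‖a‖ = 1 := norm_eq_one_of_toZModPow_two ha
  have ha0 : (a : ℚ_[3]) ≠ 0 := by
    intro h
    have : ‖a‖ = 0 := by rw [← PadicInt.padic_norm_e_of_padicInt, h, norm_zero]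
    rw [ha1] at this; exact one_ne_zero this
  have h3 : (3 : ℚ_[3]) ≠ 0 := by exact_mod_cast (Nat.prime_three.ne_zero)
  have hva : (a : ℚ_[3]).valuation = 0 := by
    have h := Padic.norm_eq_zpow_neg_valuation ha0
    rw [PadicInt.padic_norm_e_of_padicInt, ha1] at h
    push_cast at h
    have h' := zpow_right_injective₀ (by norm_num : (0 : ℝ) < 3) (by norm_num : (3 : ℝ) ≠ 1)
      (h.symm.trans (zpow_zero (3 : ℝ)).symm)
    omega
  have hv3 : (3 : ℚ_[3]).valuation = 1 := by exact_mod_cast Padic.valuation_p (p := 3)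
  have hv : D.q.valuation = 3 * k := by
    rw [hqa, Padic.valuation_mul ha0 (zpow_ne_zero _ h3), hva, zero_add, Padic.valuation_zpow, hv3, mul_one]
  rw [← hv, TateParameterData.valuation_q_eq_padicValInt_holds D]

end Twin

end Summit.BirchSwinnertonDyer.BirchSwinnertonDyer.Theorems.UniversalToricDescentTwinDecLocusCubeTest

end
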